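import Summits.ABC.StewartYu.PadicG3ParNBudgetD
import HarnessLib

/-!
# The `𝔑`-threaded odd-`p` record `PadicG3ParN` — file E: the crude v2 letters at `m ≥ 1` and the `m ≥ 1` main term

Support file (theorems only; no named facts). Cell `abc-stewartyu`, route `YuMatveevShapeRat`, crux r3 `PadicCoreOddRat`
(stmt-ABC-20503); seat p1 (record owner). When the class device is active (`m ≥ 1`, `θ₀ = ½`) the prime is small
(`log p < 16(n+1)`, lp-1's `PadicG3OddHeadline1`: `G ≤ 32(n+1)`, `K ≤ p·2^{36(n+1)}`), so the v2 letters are bounded CRUDELY: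
`ŜG ≤ 80(n+1)`, `yloadG ≤ 130(n+1)`, `LgV ≤ 2^{n+10}·C_bⁿΩK` (`C_bⁿΩK ≥ 2^{n+25}`), `W_LV ≤ 54(n+1)·Wp`, `XV ≤ (n+1)·2^{3n+10}·Wp`,
whence `main_term_le_of_m_pos : 8·2ⁿ·Zp ≤ (n+1)³C_bⁿ·2^{41n+70}·(p/log p)·Ω·Wp` (parent level `PadicG3Par`); the floor term,
the headline at every `m` and `U_floor_N` are file F.

## References
* [Yu2013] K. Yu, Acta Math. 211 (2013) — Theorem 1 (shape), §7.
* [Nesterenko2003] Yu. V. Nesterenko, LNM 1819 (2003) — §3.5 (3.23), Prop 3.9.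
-/

noncomputable section

open Finset Real

namespace Summit.ABC.StewartYu

namespace PadicG3Par

variable {n : ℕ} (P : PadicG3Par n)

/-! ### The threshold regime `m ≥ 1`: crude letters -/

/-- `C_bⁿ·Ω·K ≥ 2^{n+25}` (`K ≥ e^{8(n+1)}/2 ≥ 2^{11(n+1)}`, `C_b ≥ 64`, `Ω ≥ 1`; every `m`). [folklore] -/
theorem core_ge_two_pow (hA1 : ∀ j, 1 ≤ P.A j) (hK₀ : (P.p : ℝ) - 1 ≤ P.K₀) (hθ1 : P.θ₀ ≤ 1) :
    (2 : ℝ) ^ (n + 25) ≤ Cb ^ n * P.Ω * P.K := by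
  have hK := P.log_K_ge hK₀
  have hG := P.cG_mul_le_G
  unfold cG at hG
  have hlp := P.log_p_pos
  have hl2' : Real.log 2 < 0.6931471808 := Real.log_two_lt_d9
  have hl2 : (0 : ℝ) < Real.log 2 := Real.log_pos (by norm_num)
  have hΩ := P.one_le_Ω hA1
  have hCb := sixtyfour_le_Cb
  have hn0 : (0 : ℝ) ≤ n := Nat.cast_nonneg n
  have hn1 : (1 : ℝ) ≤ n := by exact_mod_cast P.hn
  -- `log K ≥ G − log 2 ≥ 8(n+1) − log 2` (as `(1 − θ₀) log p ≥ 0`)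
  have hK' : 8 * ((n : ℝ) + 1) - Real.log 2 ≤ Real.log P.K := by
    nlinarith [mul_nonneg (sub_nonneg.mpr hθ1) hlp.le]
  have hlogCb : 6 * Real.log 2 ≤ Real.log Cb := by
    rw [show (6 : ℝ) * Real.log 2 = Real.log (2 ^ 6) by rw [Real.log_pow]; push_cast; ring]
    exact Real.log_le_log (by norm_num) (by norm_num at hCb ⊢; linarith)
  have hpos : (0 : ℝ) < Cb ^ n * P.Ω * P.K := by
    have := P.K_pos; have : (0:ℝ) < Cb := Cb_pos; positivity
  rw [← Real.log_le_log_iff (by positivity) hpos, Real.log_pow, Real.log_mul (by positivity) P.K_pos.ne',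
    Real.log_mul (by have : (0:ℝ) < Cb := Cb_pos; positivity) P.Ω_pos.ne', Real.log_pow]
  have hlogΩ : 0 ≤ Real.log P.Ω := Real.log_nonneg hΩ
  push_cast
  nlinarith

/-- `1 ≤ m`, `θ₀ = ½`, `N_q = K` ⟹ `ŜG ≤ 80(n+1)` (`log K ≤ log p + 36(n+1) log 2 < 41(n+1)`, `log g < log 4`). [folklore] -/
theorem SdG_le_of_m_pos (hm : 1 ≤ P.m) (hθ : P.θ₀ = 1 / 2) (hNq : P.Nq = P.K) : (P.SdG : ℝ) ≤ 80 * ((n : ℝ) + 1) := by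
  have h1 := P.SdG_le_real
  have hK := P.K_le_of_m_pos hm hθ
  have hlp := P.log_p_lt_of_m_pos hm hθ
  have hG := P.G_le_of_m_pos hm hθ
  have hGg := P.G_eq_mul_g
  have hg1 := P.one_le_g
  have hKpos := P.K_pos
  have hp0 : (0 : ℝ) < P.p := by linarith [P.two_le_p]
  have hl2 : (0.6931471803 : ℝ) < Real.log 2 := Real.log_two_gt_d9
  have hl2' : Real.log 2 < 0.6931471808 := Real.log_two_lt_d9
  have hn0 : (0 : ℝ) ≤ n := Nat.cast_nonneg n
  have hn1 : (1 : ℝ) ≤ n := by exact_mod_cast P.hn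
  -- `log K ≤ log p + 36(n+1) log 2`
  have hlogK : Real.log P.K ≤ Real.log P.p + 36 * ((n : ℝ) + 1) * Real.log 2 := by
    have h := Real.log_le_log hKpos hK
    rw [Real.log_mul hp0.ne' (by positivity), Real.log_pow] at h
    push_cast at h; linarith
  -- `log g ≤ g − 1 < 3`
  have hg4 : P.g ≤ 4 := by rw [hGg] at hG; nlinarith
  have hlogg : Real.log P.g ≤ 3 := by have := Real.log_le_sub_one_of_pos (by linarith : 0 < P.g); linarith
  rw [hNq] at h1
  have hdiv : (Real.log P.K + Real.log P.g) / Real.log 2 ≤ (16 * (n + 1) + 36 * (n + 1) * Real.log 2 + 3) / Real.log 2 :=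
    div_le_div_of_nonneg_right (by linarith) (by linarith)
  have hq : (16 * ((n : ℝ) + 1) + 36 * (n + 1) * Real.log 2 + 3) / Real.log 2 ≤ 24 * (n + 1) + 36 * (n + 1) + 5 := by
    rw [div_le_iff₀ (by linarith)]; nlinarith
  linarith

/-- `1 ≤ m`, `θ₀ = ½`, `N_q = K` ⟹ `yloadG ≤ 130(n+1)`. [folklore] -/
theorem yloadG_le_of_m_pos (hm : 1 ≤ P.m) (hθ : P.θ₀ = 1 / 2) (hNq : P.Nq = P.K) : P.yloadG ≤ 130 * ((n : ℝ) + 1) := by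
  have hS := P.SdG_le_of_m_pos hm hθ hNq
  have hlp := P.log_p_lt_of_m_pos hm hθ
  have hG := P.G_le_of_m_pos hm hθ
  have hl2' : Real.log 2 < 0.6931471808 := Real.log_two_lt_d9
  have hl20 : 0 < Real.log 2 := Real.log_pos (by norm_num)
  have hn0 : (0 : ℝ) ≤ n := Nat.cast_nonneg n
  have hlogn : Real.log ((n : ℝ) + 1) ≤ n := by
    have := Real.log_le_sub_one_of_pos (show (0 : ℝ) < n + 1 by positivity); linarith
  unfold yloadG
  have h1 : ((P.SdG : ℝ) + n + 1) * Real.log 2 ≤ (81 * (n + 1)) * 0.6931471808 := by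
    have h0 : (P.SdG : ℝ) + n + 1 ≤ 81 * (n + 1) := by linarith
    exact mul_le_mul h0 hl2'.le hl20.le (by positivity)
  nlinarith

/-- `1 ≤ m`, `θ₀ = ½`, `N_q = K`, `Amax ≤ 2ⁿΩ`, `Aⱼ ≥ 1`, `K₀ ≥ p − 1` ⟹ **`LgV ≤ 2^{n+10}·C_bⁿ·Ω·K`**. [folklore] -/
theorem LgV_le_of_m_pos (hm : 1 ≤ P.m) (hθ : P.θ₀ = 1 / 2) (hNq : P.Nq = P.K) (hA1 : ∀ j, 1 ≤ P.A j)
    (hAmaxΩ : P.Amax ≤ 2 ^ n * P.Ω) (hK₀ : (P.p : ℝ) - 1 ≤ P.K₀) :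
    (P.LgV : ℝ) ≤ 2 ^ (n + 10) * (Cb ^ n * P.Ω * P.K) := by
  have hL := P.LgV_le
  have hy := P.yloadG_le_of_m_pos hm hθ hNq
  have hS := P.SdG_le_of_m_pos hm hθ hNq
  have hcore := P.core_ge_two_pow hA1 hK₀ (by rw [hθ]; norm_num)
  have hG8 := P.cG_mul_le_G
  unfold cG at hG8
  have hg1 := P.one_le_g
  have hg : 0 < P.g := by linarith
  have hΩ := P.one_le_Ω hA1
  have hK1 : (1 : ℝ) ≤ P.K := by exact_mod_cast P.one_le_K
  have hCb : (64 : ℝ) ≤ Cb := sixtyfour_le_Cb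
  have hCbn : (1 : ℝ) ≤ Cb ^ n := one_le_pow₀ (by linarith)
  set Λ : ℝ := Cb ^ n * P.Ω * P.K with hΛ
  have hΛ1 : 1 ≤ Λ := by
    rw [hΛ]; exact one_le_mul_of_one_le_of_one_le (one_le_mul_of_one_le_of_one_le hCbn hΩ) hK1
  have hΛ0 : 0 < Λ := by linarith
  have hn1 : ((n : ℝ) + 1) ≤ 2 ^ n := by exact_mod_cast Nat.succ_le_of_lt n.lt_two_pow_self
  -- main term `≤ 390 Λ`
  have hgn : 1 ≤ P.g ^ n := one_le_pow₀ hg1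
  have hmain : 24 * Cb ^ n * P.Ω * P.K * P.yloadG / (P.G * P.g ^ n) ≤ 390 * Λ := by
    have hG0' : 0 < P.G := by linarith
    have hGg0 : 0 < P.G * P.g ^ n := by positivity
    rw [div_le_iff₀ hGg0, hΛ]
    have h0 : 0 ≤ Cb ^ n * P.Ω * P.K := by rw [← hΛ]; exact hΛ0.le
    have h1 : P.yloadG ≤ 130 * (n + 1) := hy
    have h2 : 130 * ((n : ℝ) + 1) * 24 ≤ 390 * (P.G * P.g ^ n) := by nlinarith [mul_le_mul hG8 hgn (by norm_num) (by linarith)]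
    nlinarith [mul_le_mul_of_nonneg_left h1 h0]
  -- floors
  have hA : (2 * P.Amax + 1) / P.g ≤ 2 ^ (n + 1) * P.Ω + 1 := by
    rw [div_le_iff₀ hg]
    have h0 : 0 ≤ 2 ^ (n + 1) * P.Ω + 1 := by positivity
    have h1 : (2 ^ (n + 1) * P.Ω + 1) * 1 ≤ (2 ^ (n + 1) * P.Ω + 1) * P.g := mul_le_mul_of_nonneg_left hg1 h0
    have h2 : 2 * P.Amax ≤ 2 ^ (n + 1) * P.Ω := by rw [pow_succ]; linarith
    linarith
  have h2n1 : (2 : ℝ) ^ (n + 1) * P.Ω ≤ 2 ^ (n + 1) * Λ := by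
    apply mul_le_mul_of_nonneg_left _ (by positivity)
    rw [hΛ]; nlinarith [one_le_mul_of_one_le_of_one_le hCbn hK1, P.Ω_pos]
  have h25 : (2 : ℝ) ^ (n + 25) ≤ Λ := hcore
  -- total: `390Λ + Λ + 2^{n+1}Λ + 1 + 4(80(n+1)+2) + 2 ≤ 2^{n+10} Λ`
  have hrest : 1 + 4 * ((P.SdG : ℝ) + 2) + 2 ≤ (320 * (n + 1) + 11) * Λ := by nlinarith
  have e : (2 : ℝ) ^ (n + 10) = 1024 * 2 ^ n := by rw [pow_add]; ring
  have e1 : (2 : ℝ) ^ (n + 1) = 2 * 2 ^ n := by rw [pow_succ]; ring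
  have hcoef : 390 + 1 + 2 * (2 : ℝ) ^ n + (320 * (n + 1) + 11) ≤ 1024 * 2 ^ n := by nlinarith
  calc (P.LgV : ℝ) ≤ 24 * Cb ^ n * P.Ω * P.K * P.yloadG / (P.G * P.g ^ n) + 2 ^ (n + 25) +
        (2 * P.Amax + 1) / P.g + 4 * (P.SdG + 2) + 2 := hL
    _ ≤ 390 * Λ + Λ + (2 ^ (n + 1) * Λ + 1) + 4 * (P.SdG + 2) + 2 := by linarith
    _ ≤ (390 + 1 + 2 * 2 ^ n + (320 * (n + 1) + 11)) * Λ := by rw [e1]; nlinarith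
    _ ≤ (1024 * 2 ^ n) * Λ := mul_le_mul_of_nonneg_right hcoef hΛ0.le
    _ = 2 ^ (n + 10) * Λ := by rw [e]

/-- `1 ≤ m`, … ⟹ **`W_LV ≤ 54(n+1)·Wp`** (`log LV ≤ log 4 + (n+10) log 2 + n log C_b + n log Amax + log K`). [folklore] -/
theorem WLV_le_of_m_pos (hm : 1 ≤ P.m) (hθ : P.θ₀ = 1 / 2) (hNq : P.Nq = P.K) (hA1 : ∀ j, 1 ≤ P.A j)
    (hAmaxΩ : P.Amax ≤ 2 ^ n * P.Ω) (hK₀ : (P.p : ℝ) - 1 ≤ P.K₀) : P.WLV ≤ 54 * ((n : ℝ) + 1) * P.Wp := by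
  have h1 := P.WLV_le
  have h2 := P.log_LV_le
  have hL := P.LgV_le_of_m_pos hm hθ hNq hA1 hAmaxΩ hK₀
  have hK := P.K_le_of_m_pos hm hθ
  have hlp := P.log_p_lt_of_m_pos hm hθ
  have hG := P.G_le_of_m_pos hm hθ
  have hGg := P.G_eq_mul_g
  have hg1 := P.one_le_g
  have hlogΩ := P.log_Ω_le hA1
  obtain ⟨hlW, hWW, hAW, _⟩ := P.Wplus_facts hA1
  rw [P.Wplus_eq_Wp] at hlW hWW hAW
  have hWp := P.one_le_Wp
  have hCb5 := log_Cb_le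
  have hl2' : Real.log 2 < 0.6931471808 := Real.log_two_lt_d9
  have hn0 : (0 : ℝ) ≤ n := Nat.cast_nonneg n
  have hKpos := P.K_pos
  have hΩ := P.Ω_pos
  have hCb0 : (0 : ℝ) < Cb := Cb_pos
  have hp0 : (0 : ℝ) < P.p := by linarith [P.two_le_p]
  have hL1 := P.one_le_LgV
  -- `log LgV ≤ (n+10) log 2 + n log C_b + log Ω + log K`
  have hlogL : Real.log P.LgV ≤ (n + 10) * Real.log 2 + n * Real.log Cb + Real.log P.Ω + Real.log P.K := by
    have h := Real.log_le_log (by linarith) hL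
    rw [Real.log_mul (by positivity) (by positivity), Real.log_pow, Real.log_mul (by positivity) hKpos.ne',
      Real.log_mul (by positivity) hΩ.ne', Real.log_pow] at h
    push_cast at h; linarith
  have hlogK : Real.log P.K ≤ Real.log P.p + 36 * ((n : ℝ) + 1) * Real.log 2 := by
    have h := Real.log_le_log hKpos hK
    rw [Real.log_mul hp0.ne' (by positivity), Real.log_pow] at h
    push_cast at h; linarith
  have hg4 : P.g ≤ 4 := by rw [hGg] at hG; nlinarith
  have hlogg : Real.log P.g ≤ 3 := by have := Real.log_le_sub_one_of_pos (by linarith : 0 < P.g); linarith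
  have hlogA0 : 0 ≤ Real.log P.Amax := Real.log_nonneg (P.one_le_Amax hA1)
  nlinarith [mul_le_mul_of_nonneg_left hAW hn0]

/-- `1 ≤ m`, … ⟹ **`XV ≤ (n+1)·2^{3n+10}·Wp`**. [folklore] -/
theorem XV_le_of_m_pos (hm : 1 ≤ P.m) (hθ : P.θ₀ = 1 / 2) (hNq : P.Nq = P.K) (hA1 : ∀ j, 1 ≤ P.A j)
    (hAmaxΩ : P.Amax ≤ 2 ^ n * P.Ω) (hK₀ : (P.p : ℝ) - 1 ≤ P.K₀) :
    (P.XV : ℝ) ≤ ((n : ℝ) + 1) * 2 ^ (3 * n + 10) * P.Wp := by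
  have hX := P.XV_le
  have hW := P.WLV_le_of_m_pos hm hθ hNq hA1 hAmaxΩ hK₀
  have hL := P.LgV_le_of_m_pos hm hθ hNq hA1 hAmaxΩ hK₀
  have hG8 := P.cG_mul_le_G
  unfold cG at hG8
  have hG := P.G_le_of_m_pos hm hθ
  have hGg := P.G_eq_mul_g
  have hg1 := P.one_le_g
  have hg : 0 < P.g := by linarith
  have hWp := P.one_le_Wp
  have hG0 : 0 < P.G := by linarith
  have hKpos := P.K_pos
  have hΩ := P.Ω_pos
  have hCb0 : (0 : ℝ) < Cb := Cb_pos
  have hcore0 : 0 < Cb ^ n * P.Ω * P.K := by positivity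
  have hn0 : (0 : ℝ) ≤ n := Nat.cast_nonneg n
  have hWLV0 : 0 ≤ P.WLV := by linarith [P.WLV_ge_one]
  -- (i) `64(n+1) WLV/G ≤ 8 WLV ≤ 432 (n+1) Wp`
  have h1 : 64 * ((n : ℝ) + 1) * P.WLV / P.G ≤ 8 * P.WLV := by
    rw [div_le_iff₀ hG0]; nlinarith
  -- (ii) `1.5(n+1) LgV g^{n-1}/(C_bⁿΩK) ≤ 1.5(n+1) 2^{n+10} 4^{n-1} ≤ (n+1)·2^{3n+9}`
  have hg4 : P.g ≤ 4 := by rw [hGg] at hG; nlinarith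
  have hgn : P.g ^ (n - 1) ≤ (4 : ℝ) ^ (n - 1) := pow_le_pow_left₀ hg.le hg4 _
  have h4n : (4 : ℝ) ^ (n - 1) * 4 = 2 ^ (2 * n) := by
    have hn1 := P.hn
    obtain ⟨k, hk⟩ : ∃ k, n = k + 1 := ⟨n - 1, by omega⟩
    subst hk
    rw [Nat.add_sub_cancel, ← pow_succ, show (4 : ℝ) = 2 ^ 2 by norm_num, ← pow_mul]
  have h2 : (3 / 2) * ((n : ℝ) + 1) * P.LgV * P.g ^ (n - 1) / (Cb ^ n * P.Ω * P.K) ≤ (n + 1) * 2 ^ (3 * n + 9) := by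
    rw [div_le_iff₀ hcore0]
    have hL' : (P.LgV : ℝ) * P.g ^ (n - 1) ≤ 2 ^ (n + 10) * (Cb ^ n * P.Ω * P.K) * 4 ^ (n - 1) :=
      mul_le_mul hL hgn (by positivity) (by positivity)
    have h48 : (2 : ℝ) ^ (n + 10) * 4 ^ (n - 1) * 4 = 2 ^ (3 * n + 8) * 4 := by
      rw [mul_assoc, h4n, ← pow_add, show (4 : ℝ) = 2 ^ 2 by norm_num, ← pow_add]; ring_nf
    have h48' : (2 : ℝ) ^ (n + 10) * 4 ^ (n - 1) = 2 ^ (3 * n + 8) := by linarith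
    have hL'' : (P.LgV : ℝ) * P.g ^ (n - 1) ≤ 2 ^ (3 * n + 8) * (Cb ^ n * P.Ω * P.K) := by
      calc (P.LgV : ℝ) * P.g ^ (n - 1) ≤ 2 ^ (n + 10) * (Cb ^ n * P.Ω * P.K) * 4 ^ (n - 1) := hL'
        _ = (2 ^ (n + 10) * 4 ^ (n - 1)) * (Cb ^ n * P.Ω * P.K) := by ring
        _ = 2 ^ (3 * n + 8) * (Cb ^ n * P.Ω * P.K) := by rw [h48']
    have e9 : (2 : ℝ) ^ (3 * n + 9) = 2 * 2 ^ (3 * n + 8) := by rw [pow_succ]; ring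
    rw [e9]
    have hn10 : (0 : ℝ) ≤ (n : ℝ) + 1 := by positivity
    have hP0 : 0 ≤ ((n : ℝ) + 1) * (2 ^ (3 * n + 8) * (Cb ^ n * P.Ω * P.K)) := by positivity
    nlinarith [mul_le_mul_of_nonneg_left hL'' hn10, hP0]
  -- assemble: `XV ≤ 8·54(n+1)Wp + (n+1)2^{3n+9} + 64(n+1) + 2 ≤ (n+1) 2^{3n+10} Wp`
  have h29 : (498 : ℝ) ≤ 2 ^ (3 * n + 9) := by
    have : (2 : ℝ) ^ 9 ≤ 2 ^ (3 * n + 9) := pow_le_pow_right₀ (by norm_num) (by omega)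
    nlinarith
  have e3 : (2 : ℝ) ^ (3 * n + 10) = 2 * 2 ^ (3 * n + 9) := by rw [pow_succ]; ring
  rw [e3]
  have hn1 : (1 : ℝ) ≤ (n : ℝ) + 1 := by linarith
  nlinarith [mul_nonneg (by positivity : (0:ℝ) ≤ (n:ℝ) + 1) (by positivity : (0:ℝ) ≤ 2 ^ (3 * n + 9)),
    mul_le_mul_of_nonneg_left hWp (by positivity : (0:ℝ) ≤ ((n:ℝ) + 1) * 2 ^ (3 * n + 9))]

/-- `1 ≤ m`, `θ₀ = ½` ⟹ `K·log p ≤ (n+1)·2^{36n+40}·p`. [folklore] -/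
theorem K_log_le_of_m_pos (hm : 1 ≤ P.m) (hθ : P.θ₀ = 1 / 2) :
    (P.K : ℝ) * Real.log P.p ≤ ((n : ℝ) + 1) * 2 ^ (36 * n + 40) * P.p := by
  have hK := P.K_le_of_m_pos hm hθ
  have hlp := P.log_p_lt_of_m_pos hm hθ
  have hl := P.log_p_pos
  have hp0 : (0 : ℝ) < P.p := by linarith [P.two_le_p]
  have e : (2 : ℝ) ^ (36 * n + 40) = 16 * 2 ^ (36 * (n + 1)) := by
    rw [show 36 * n + 40 = 36 * (n + 1) + 4 by ring, pow_add]; ring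
  rw [e]
  calc (P.K : ℝ) * Real.log P.p ≤ P.p * 2 ^ (36 * (n + 1)) * (16 * (n + 1)) :=
        mul_le_mul hK hlp.le hl.le (by positivity)
    _ = ((n : ℝ) + 1) * (16 * 2 ^ (36 * (n + 1))) * P.p := by ring

/-- `1 ≤ m`, … ⟹ **`8·2ⁿ·Zp ≤ (n+1)³·C_bⁿ·2^{41n+70}·(p/log p)·Ω·Wp`**. [cite: Yu2013, Theorem 1 (shape)] -/
theorem main_term_le_of_m_pos (hm : 1 ≤ P.m) (hθ : P.θ₀ = 1 / 2) (hNq : P.Nq = P.K) (hA1 : ∀ j, 1 ≤ P.A j)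
    (hAmaxΩ : P.Amax ≤ 2 ^ n * P.Ω) (hK₀ : (P.p : ℝ) - 1 ≤ P.K₀) :
    8 * 2 ^ n * P.Zp ≤ ((n : ℝ) + 1) ^ 3 * Cb ^ n * 2 ^ (41 * n + 70) * (P.p / Real.log P.p) * P.Ω * P.Wp := by
  have hX := P.XV_le_of_m_pos hm hθ hNq hA1 hAmaxΩ hK₀
  have hL := P.LgV_le_of_m_pos hm hθ hNq hA1 hAmaxΩ hK₀
  have hKl := P.K_log_le_of_m_pos hm hθ
  have hG := P.G_le_of_m_pos hm hθ
  have hGg := P.G_eq_mul_g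
  have hg1 := P.one_le_g
  have hl := P.log_p_pos
  have hWp := P.one_le_Wp
  have hΩ := P.Ω_pos
  have hKpos := P.K_pos
  have hCb0 : (0 : ℝ) < Cb := Cb_pos
  have hn0 : (0 : ℝ) ≤ n := Nat.cast_nonneg n
  have hG0 : 0 ≤ P.G := by linarith [P.eight_le_G]
  -- `G g ≤ 128(n+1)`
  have hGg' : P.G * P.g ≤ 128 * ((n : ℝ) + 1) := by
    have e : P.G * P.g = P.G ^ 2 / (8 * (n + 1)) := by rw [hGg]; field_simp
    rw [e, div_le_iff₀ (by positivity)]; nlinarith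
  -- `Zp = G g XV LgV ≤ 128(n+1)·(n+1)2^{3n+10}Wp·2^{n+10}C_bⁿΩK`
  have hX0 : (0 : ℝ) ≤ P.XV := by positivity
  have hL0 : (0 : ℝ) ≤ P.LgV := by positivity
  have h1 : P.Zp ≤ 128 * ((n : ℝ) + 1) * ((n + 1) * 2 ^ (3 * n + 10) * P.Wp) * (2 ^ (n + 10) * (Cb ^ n * P.Ω * P.K)) := by
    unfold Zp
    have hXL : (P.XV : ℝ) * P.LgV ≤ ((n + 1) * 2 ^ (3 * n + 10) * P.Wp) * (2 ^ (n + 10) * (Cb ^ n * P.Ω * P.K)) :=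
      mul_le_mul hX hL hL0 (by positivity)
    have hGg0 : 0 ≤ P.G * P.g := by positivity
    calc P.G * (P.g * P.XV * P.LgV) = (P.G * P.g) * (P.XV * P.LgV) := by ring
      _ ≤ 128 * ((n : ℝ) + 1) * (((n + 1) * 2 ^ (3 * n + 10) * P.Wp) * (2 ^ (n + 10) * (Cb ^ n * P.Ω * P.K))) :=
          mul_le_mul hGg' hXL (by positivity) (by positivity)
      _ = _ := by ring
  -- insert `K log p ≤ (n+1) 2^{36n+40} p` and divide by `log p`
  have h2 : 8 * 2 ^ n * P.Zp * Real.log P.p ≤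
      ((n : ℝ) + 1) ^ 3 * Cb ^ n * 2 ^ (41 * n + 70) * P.p * P.Ω * P.Wp := by
    have h3 : 8 * 2 ^ n * P.Zp * Real.log P.p ≤
        8 * 2 ^ n * (128 * ((n : ℝ) + 1) * ((n + 1) * 2 ^ (3 * n + 10) * P.Wp) * (2 ^ (n + 10) * (Cb ^ n * P.Ω * P.K))) * Real.log P.p :=
      mul_le_mul_of_nonneg_right (mul_le_mul_of_nonneg_left h1 (by positivity)) hl.le
    have e : 8 * 2 ^ n * (128 * ((n : ℝ) + 1) * ((n + 1) * 2 ^ (3 * n + 10) * P.Wp) * (2 ^ (n + 10) * (Cb ^ n * P.Ω * P.K))) * Real.log P.p =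
        ((n : ℝ) + 1) ^ 2 * Cb ^ n * 2 ^ (5 * n + 30) * P.Ω * P.Wp * (P.K * Real.log P.p) := by
      have : (2 : ℝ) ^ (5 * n + 30) = 8 * 128 * 2 ^ n * 2 ^ (3 * n + 10) * 2 ^ (n + 10) := by
        rw [show (8 : ℝ) * 128 = 2 ^ 10 by norm_num, ← pow_add, ← pow_add, ← pow_add]; ring_nf
      rw [this]; ring
    rw [e] at h3
    have h4 : ((n : ℝ) + 1) ^ 2 * Cb ^ n * 2 ^ (5 * n + 30) * P.Ω * P.Wp * (P.K * Real.log P.p) ≤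
        ((n : ℝ) + 1) ^ 2 * Cb ^ n * 2 ^ (5 * n + 30) * P.Ω * P.Wp * (((n : ℝ) + 1) * 2 ^ (36 * n + 40) * P.p) :=
      mul_le_mul_of_nonneg_left hKl (by positivity)
    have e2 : ((n : ℝ) + 1) ^ 2 * Cb ^ n * 2 ^ (5 * n + 30) * P.Ω * P.Wp * (((n : ℝ) + 1) * 2 ^ (36 * n + 40) * P.p) =
        ((n : ℝ) + 1) ^ 3 * Cb ^ n * 2 ^ (41 * n + 70) * P.p * P.Ω * P.Wp := by
      have : (2 : ℝ) ^ (41 * n + 70) = 2 ^ (5 * n + 30) * 2 ^ (36 * n + 40) := by rw [← pow_add]; ring_nf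
      rw [this]; ring
    linarith
  have e3 : ((n : ℝ) + 1) ^ 3 * Cb ^ n * 2 ^ (41 * n + 70) * (P.p / Real.log P.p) * P.Ω * P.Wp =
      ((n : ℝ) + 1) ^ 3 * Cb ^ n * 2 ^ (41 * n + 70) * P.p * P.Ω * P.Wp / Real.log P.p := by
    field_simp
  rw [e3, le_div_iff₀ hl]
  exact h2

end PadicG3Par

end Summit.ABC.StewartYu
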